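import Summits.CriticalPhenomena.SAWScalingLimit.Theses.SAWRenewalTightness
import Summits.CriticalPhenomena.SAWScalingLimit.Theorems.SAWRenewalTightnessTightOfShellCrossing
import Summits.CriticalPhenomena.SAWScalingLimit.Theorems.ShellCrossingBound.Negative.OfEventualTight
import Summits.CriticalPhenomena.SAWScalingLimit.Theorems.SAWRenewalTightnessEventualTightConfinement
import Summits.CriticalPhenomena.SAWScalingLimit.Theorems.SAWRenewalTightnessEventualTightShellCountOfMultiShadow
import Summits.CriticalPhenomena.SAWScalingLimit.Theorems.SAWRenewalTightnessEventualTightShellCountOfCleanMultiShadow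

/-!
# Crux `SAWRenewalTightness.EventualTight` (stmt-CriticalPhenomena-1372): objects and reductions of the line `Sketch`

Definitions and PROVED reductions (no stub is asserted here) of the checked skeleton
`Summits/CriticalPhenomena/SAWScalingLimit/Cruxes/EventualTight/Lines/Sketch.lean` (lead
`prover-line-stmt-CriticalPhenomena-1372-0`, `ledger skeleton check` 2026-08-16; card `shadowing-hyperspace`,
ideator 2), so that the equivalences the line rests on are citable tree theorems for the ten routes that share
this crux:

* §A vocabulary: `HasShadowingPair` / `HasShadowingFamily` (mutually `η`-shadowing separate traversal strands
  of a shell, ideator 2), `ShellCountTight` (per-shell traversal-count tightness, ideator 1), `Confinement`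
  (S1), `MultiShadowDecay` (S3, the open atom), `NoShadowingEventually` (the card's two-strand target with an
  eventual mesh quantifier).
* §B reductions, all kernel-checked from landed files: `Confinement` HOLDS (`stub_confinement`, landed
  `SAWRenewalTightnessEventualTightConfinement`); `MultiShadowDecay → ShellCountTight`
  (`stub_shellCountOfMultiShadow`, landed `SAWRenewalTightnessEventualTightShellCountOfMultiShadow`: the
  generalised hyperspace pigeonhole + the coarse-mesh cutoff); `ShellCountTight ↔ EventualTight`
  (`TightOfShellCrossing_proof` + `anyTarget_of_eventualTight`, both landed); hence
  `MultiShadowDecay ↔ EventualTight` (the atom of the line is crux-EQUIVALENT) and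
  `NoShadowingEventually → EventualTight` (the two-strand target suffices).

Every implication towards the crux is stated as a named `Prop` with a `_holds` witness or as an `Iff`, never as
a theorem whose conclusion is the crux decl under a hypothesis (the crux stays open: nothing here credits it).
The two equivalences are also stated UNFOLDED under their registered obligation names on the crux item
(`Theorems.shellCountTight_iff_eventualTight`, `Theorems.multiShadowDecay_iff_eventualTight`; `ledger workitem
stubs stmt-CriticalPhenomena-1372`).  The statement `def`s carry no provenance tag on purpose: they are objects the
line posits (route-side), not published facts.
Sources: M. Aizenman, A. Burchard, Duke Math. J. 99 (1999) §2, Lemma 4.1 [AizenmanBurchardDuke1999]; the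
hyperspace/Blaschke pigeonhole is folklore.
-/

noncomputable section

namespace Summit.CriticalPhenomena.SAWScalingLimit.Theorems.EventualTight.Sketch

open MeasureTheory Filter Topology Set Metric
open scoped ENNReal NNReal unitInterval
open Literature.Probability.RandomPlanarGeometry Literature.Probability.LatticeModels
open Summit.CriticalPhenomena.SAWScalingLimit.Theses.SAWRenewalTightness
  (EventualTight ShellCrossingBound TightOfShellCrossing)

/-! ## A. Vocabulary -/

/-- **A mutually shadowing pair of traversal strands**: two segments of `γ` on disjoint, ordered parameter
intervals, each a traversal of the shell `D(x; r, R)` (`Curve.IsTraversal`), each within distance `η` of the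
other pointwise (Hausdorff distance `≤ η`). -/
def HasShadowingPair (γ : Curve ℂ) (x : ℂ) (r R η : ℝ) : Prop :=
  ∃ s₁ t₁ s₂ t₂ : I, γ.IsTraversal x r R s₁ t₁ ∧ γ.IsTraversal x r R s₂ t₂ ∧ t₁ < s₂ ∧
    (∀ u : I, s₁ ≤ u → u ≤ t₁ → ∃ v : I, s₂ ≤ v ∧ v ≤ t₂ ∧ dist (γ u) (γ v) ≤ η) ∧
    (∀ v : I, s₂ ≤ v → v ≤ t₂ → ∃ u : I, s₁ ≤ u ∧ u ≤ t₁ ∧ dist (γ u) (γ v) ≤ η)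

/-- **A mutually shadowing family of `j` traversal strands**: `j` segments of `γ` on pairwise disjoint
parameter intervals listed increasingly (as in `Curve.HasTraversals`), each a traversal of `D(x; r, R)`,
pairwise mutually `η`-shadowing. -/
def HasShadowingFamily (γ : Curve ℂ) (j : ℕ) (x : ℂ) (r R η : ℝ) : Prop :=
  ∃ s t : Fin j → I, (∀ i, γ.IsTraversal x r R (s i) (t i)) ∧ (∀ ⦃i i' : Fin j⦄, i < i' → t i < s i') ∧
    ∀ (i i' : Fin j) (u : I), s i ≤ u → u ≤ t i → ∃ v : I, s i' ≤ v ∧ v ≤ t i' ∧ dist (γ u) (γ v) ≤ η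

/-- **ShellCountTight** (the no-exponent criterion): for every Dobrushin domain and endpoint approximation
there is `δ₀ > 0` such that for every fixed genuine shell the number of separate traversals by the critical SAW
polyline is a tight family over `δ ∈ (0, δ₀]`. -/
def ShellCountTight : Prop :=
  ∀ (D : DobrushinDomain) (a b : ℝ → Site 2), SAW.IsEndpointApprox D a b →
    ∃ δ₀ : ℝ, 0 < δ₀ ∧ ∀ (x : ℂ) (ρ R : ℝ), 0 < ρ → ρ < R → ∀ η : ℝ, 0 < η →
      ∃ k : ℕ, ∀ δ ∈ Set.Ioc (0 : ℝ) δ₀,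
        SAW.law D.carrier δ (a δ) (b δ)
          {γ | (⟨γ.walk.toCurve (meshPoint δ)⟩ : Curve ℂ).HasTraversals k x ρ R}
          ≤ ENNReal.ofReal η

/-- **Confinement** (stub S1 of the line): for small meshes every SAW polyline of `Ω_δ` from `a_δ` to `b_δ`
lies in one fixed compact disc. -/
def Confinement : Prop :=
  ∀ (D : DobrushinDomain) (a b : ℝ → Site 2), SAW.IsEndpointApprox D a b →
    ∃ (L δ₀ : ℝ), 0 < δ₀ ∧ ∀ δ ∈ Set.Ioc (0 : ℝ) δ₀,
      ∀ γ : SAW.DomainSAW D.carrier δ (a δ) (b δ),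
        (⟨γ.walk.toCurve (meshPoint δ)⟩ : Curve ℂ).range ⊆ Metric.closedBall (0 : ℂ) L

/-- **MultiShadowDecay** (stub S3 of the line, its open atom): for every genuine shell and `θ > 0` there are
ONE resolution `η > 0`, a number of strands `j` and a mesh threshold `δ₁ > 0` such that `j` pairwise mutually
`η`-shadowing separate traversal strands have probability `≤ θ` for all `δ ∈ (0, δ₁]`. -/
def MultiShadowDecay : Prop :=
  ∀ (D : DobrushinDomain) (a b : ℝ → Site 2), SAW.IsEndpointApprox D a b →
    ∀ (x : ℂ) (r R : ℝ), 0 < r → r < R → ∀ θ : ℝ, 0 < θ →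
      ∃ η : ℝ, 0 < η ∧ ∃ (j : ℕ) (δ₁ : ℝ), 0 < δ₁ ∧ ∀ δ ∈ Set.Ioc (0 : ℝ) δ₁,
        SAW.law D.carrier δ (a δ) (b δ)
          {γ | HasShadowingFamily (⟨γ.walk.toCurve (meshPoint δ)⟩ : Curve ℂ) j x r R η}
          ≤ ENNReal.ofReal θ

/-- **NoShadowingEventually** (the card's two-strand target): per shell and `θ > 0` some resolution `η > 0`
makes a mutually `η`-shadowing PAIR of traversal strands `θ`-improbable for all small meshes.  Strictly
stronger than the crux (it also forbids retracing subsequential limits). -/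
def NoShadowingEventually : Prop :=
  ∀ (D : DobrushinDomain) (a b : ℝ → Site 2), SAW.IsEndpointApprox D a b →
    ∀ (x : ℂ) (r R : ℝ), 0 < r → r < R → ∀ θ : ℝ, 0 < θ →
      ∃ η : ℝ, 0 < η ∧ ∃ δ₁ : ℝ, 0 < δ₁ ∧ ∀ δ ∈ Set.Ioc (0 : ℝ) δ₁,
        SAW.law D.carrier δ (a δ) (b δ)
          {γ | HasShadowingPair (⟨γ.walk.toCurve (meshPoint δ)⟩ : Curve ℂ) x r R η}
          ≤ ENNReal.ofReal θ

/-- The reduction through the sibling crux, as a named `Prop`. -/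
def ShellCrossingBoundOfShellCount : Prop := ShellCountTight → ShellCrossingBound

/-- `TightOfShellCount`: the no-exponent criterion implies the crux (named `Prop`). -/
def TightOfShellCount : Prop := ShellCountTight → EventualTight

/-- `TightOfNoShadowing`: the two-strand target implies the crux (named `Prop`). -/
def TightOfNoShadowing : Prop := NoShadowingEventually → EventualTight

/-! ## B. Reductions (all proved) -/

/-- `Confinement` holds: it is the landed stub S1 verbatim. [folklore] -/
theorem confinement_holds : Confinement := Theorems.stub_confinement

/-- The atom gives per-shell count tightness: the landed stub S2 (generalised hyperspace pigeonhole +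
coarse-mesh cutoff) fed with the landed S1. [folklore] -/
theorem shellCountTight_of_multiShadowDecay (h : MultiShadowDecay) : ShellCountTight :=
  Theorems.stub_shellCountOfMultiShadow Theorems.stub_confinement h

/-- **Per-shell count tightness gives the Aizenman–Burchard dress** (`K = 1`, `λ = 3`, the same `δ₀`):
choose the shell-dependent threshold for the target `(ρ/R)^3`. [folklore] -/
theorem shellCrossingBoundOfShellCount_holds : ShellCrossingBoundOfShellCount := by
  intro h D a b hab
  obtain ⟨δ₀, hδ₀, H⟩ := h D a b hab
  have key : ∀ (x : ℂ) (ρ R : ℝ), ∃ k : ℕ, 0 < ρ → ρ < R → ∀ δ ∈ Set.Ioc (0 : ℝ) δ₀,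
      SAW.law D.carrier δ (a δ) (b δ)
        {γ | (⟨γ.walk.toCurve (meshPoint δ)⟩ : Curve ℂ).HasTraversals k x ρ R}
        ≤ ENNReal.ofReal (1 * (ρ / R) ^ (3 : ℝ)) := by
    intro x ρ R
    by_cases hρR : 0 < ρ ∧ ρ < R
    · have hpos : 0 < 1 * (ρ / R) ^ (3 : ℝ) := by
        rw [one_mul]
        exact Real.rpow_pos_of_pos (div_pos hρR.1 (hρR.1.trans hρR.2)) _
      obtain ⟨k, hk⟩ := H x ρ R hρR.1 hρR.2 _ hpos
      exact ⟨k, fun _ _ => hk⟩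
    · exact ⟨0, fun h1 h2 => absurd ⟨h1, h2⟩ hρR⟩
  choose k hk using key
  exact ⟨k, 1, 3, δ₀, by norm_num, hδ₀, fun δ hδ x ρ R hδρ hρR _ =>
    hk x ρ R (hδ.1.trans_le hδρ) hρR δ hδ⟩

/-- **TightOfShellCount holds**: per-shell count tightness implies the crux, through `ShellCrossingBound`
and the landed Aizenman–Burchard criterion `TightOfShellCrossing_proof`.
[cite: AizenmanBurchardDuke1999, Lemma 4.1] -/
theorem tightOfShellCount_holds : TightOfShellCount := fun h =>
  Theorems.TightOfShellCrossing_proof (shellCrossingBoundOfShellCount_holds h)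

/-- The converse (AB99 Lemma 4.1 "only if", via the landed `anyTarget_of_eventualTight`): the crux implies
per-shell count tightness. [cite: AizenmanBurchardDuke1999, Lemma 4.1] -/
theorem shellCountTight_of_eventualTight (hT : EventualTight) : ShellCountTight := by
  intro D a b hab
  obtain ⟨δ₀, hδ₀, H⟩ :=
    Theorems.ShellCrossingBound.Negative.anyTarget_of_eventualTight hT D a b hab
  refine ⟨δ₀, hδ₀, fun x ρ R hρ hρR η hη => ?_⟩
  obtain ⟨k, hk⟩ := H (fun _ _ _ => ENNReal.ofReal η)
    (fun _ _ _ _ _ => (ENNReal.ofReal_pos.2 hη).ne')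
  exact ⟨k x ρ R, fun δ hδ => hk δ hδ x ρ R hρ hρR⟩

/-- **`ShellCountTight ↔ EventualTight`**: tightness of the critical SAW needs no exponent. [folklore] -/
theorem shellCountTight_iff_eventualTight : ShellCountTight ↔ EventualTight :=
  ⟨fun h => tightOfShellCount_holds h, shellCountTight_of_eventualTight⟩

/-- The atom is implied by the crux: `j` shadowing strands are `j` separate traversals. [folklore] -/
theorem multiShadowDecay_of_eventualTight (hT : EventualTight) : MultiShadowDecay := by
  intro D a b hab x r R hr hrR θ hθ
  obtain ⟨δ₀, hδ₀, H⟩ := shellCountTight_of_eventualTight hT D a b hab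
  obtain ⟨k, hk⟩ := H x r R hr hrR θ hθ
  refine ⟨1, one_pos, k, δ₀, hδ₀, fun δ hδ => le_trans (measure_mono fun γ hγ => ?_) (hk δ hδ)⟩
  obtain ⟨s, t, hst, hsep, -⟩ := hγ
  exact ⟨s, t, hst, hsep⟩

/-- **`MultiShadowDecay ↔ EventualTight`**: the atom of the line `Sketch` is crux-EQUIVALENT (so a
refutation of the atom refutes the crux, and conversely nothing weaker than the crux is being asked).
[folklore] -/
theorem multiShadowDecay_iff_eventualTight : MultiShadowDecay ↔ EventualTight :=
  ⟨fun h => tightOfShellCount_holds (shellCountTight_of_multiShadowDecay h),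
    multiShadowDecay_of_eventualTight⟩

/-- **Registered form** (crux item stmt-CriticalPhenomena-1372, obligation
`shellCountTight_iff_eventualTight`): `ShellCountTight` unfolded `↔` the crux decl. [folklore] -/
theorem _root_.Summit.CriticalPhenomena.SAWScalingLimit.Theorems.shellCountTight_iff_eventualTight :
    (∀ (D : DobrushinDomain) (a b : ℝ → Site 2), SAW.IsEndpointApprox D a b →
      ∃ δ₀ : ℝ, 0 < δ₀ ∧ ∀ (x : ℂ) (ρ R : ℝ), 0 < ρ → ρ < R → ∀ η : ℝ, 0 < η →
        ∃ k : ℕ, ∀ δ ∈ Set.Ioc (0 : ℝ) δ₀,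
          SAW.law D.carrier δ (a δ) (b δ)
            {γ | (⟨γ.walk.toCurve (meshPoint δ)⟩ : Curve ℂ).HasTraversals k x ρ R}
            ≤ ENNReal.ofReal η) ↔
    Summit.CriticalPhenomena.SAWScalingLimit.Theses.SAWRenewalTightness.EventualTight :=
  Summit.CriticalPhenomena.SAWScalingLimit.Theorems.EventualTight.Sketch.shellCountTight_iff_eventualTight

/-- **Registered form** (crux item stmt-CriticalPhenomena-1372, obligation
`multiShadowDecay_iff_eventualTight`): the registered atom `stub_multiShadowDecay`, verbatim, `↔` the
crux decl — the atom of the line `Sketch` is exactly crux-sized. [folklore] -/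
theorem _root_.Summit.CriticalPhenomena.SAWScalingLimit.Theorems.multiShadowDecay_iff_eventualTight :
    (∀ (D : DobrushinDomain) (a b : ℝ → Site 2), SAW.IsEndpointApprox D a b →
      ∀ (x : ℂ) (r R : ℝ), 0 < r → r < R → ∀ θ : ℝ, 0 < θ →
        ∃ η : ℝ, 0 < η ∧ ∃ (j : ℕ) (δ₁ : ℝ), 0 < δ₁ ∧ ∀ δ ∈ Set.Ioc (0 : ℝ) δ₁,
          SAW.law D.carrier δ (a δ) (b δ)
            {γ | ∃ s t : Fin j → unitInterval,
              (∀ i, (⟨γ.walk.toCurve (meshPoint δ)⟩ : Curve ℂ).IsTraversal x r R (s i) (t i)) ∧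
              (∀ ⦃i i' : Fin j⦄, i < i' → t i < s i') ∧
              ∀ (i i' : Fin j) (u : unitInterval), s i ≤ u → u ≤ t i →
                ∃ v : unitInterval, s i' ≤ v ∧ v ≤ t i' ∧
                  dist ((⟨γ.walk.toCurve (meshPoint δ)⟩ : Curve ℂ) u)
                    ((⟨γ.walk.toCurve (meshPoint δ)⟩ : Curve ℂ) v) ≤ η}
            ≤ ENNReal.ofReal θ) ↔
    Summit.CriticalPhenomena.SAWScalingLimit.Theses.SAWRenewalTightness.EventualTight :=
  Summit.CriticalPhenomena.SAWScalingLimit.Theorems.EventualTight.Sketch.multiShadowDecay_iff_eventualTight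

/-- A shadowing family of two strands is a shadowing pair. [folklore] -/
theorem hasShadowingPair_of_hasShadowingFamily_two {γ : Curve ℂ} {x : ℂ} {r R η : ℝ}
    (h : HasShadowingFamily γ 2 x r R η) : HasShadowingPair γ x r R η := by
  obtain ⟨s, t, hst, hsep, hclose⟩ := h
  refine ⟨s 0, t 0, s 1, t 1, hst 0, hst 1, hsep (by decide), hclose 0 1, fun v hsv hvt => ?_⟩
  obtain ⟨u, hsu, hut, hd⟩ := hclose 1 0 v hsv hvt
  exact ⟨u, hsu, hut, by rwa [dist_comm] at hd⟩

/-- **The two-strand target closes the atom** (`j = 2`). [folklore] -/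
theorem multiShadowDecay_of_noShadowingEventually (h : NoShadowingEventually) : MultiShadowDecay := by
  intro D a b hab x r R hr hrR θ hθ
  obtain ⟨η, hη, δ₁, hδ₁, hbound⟩ := h D a b hab x r R hr hrR θ hθ
  refine ⟨η, hη, 2, δ₁, hδ₁, fun δ hδ => le_trans (measure_mono fun γ hγ => ?_) (hbound δ hδ)⟩
  exact hasShadowingPair_of_hasShadowingFamily_two hγ

/-- **TightOfNoShadowing holds**: the card's two-strand target implies the crux. [folklore] -/
theorem tightOfNoShadowing_holds : TightOfNoShadowing := fun h =>
  multiShadowDecay_iff_eventualTight.1 (multiShadowDecay_of_noShadowingEventually h)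

/-! ### §C The reshaped atom of skeleton v4 (lead c1, 2026-08-16): clean, co-oriented shadowing strands

The open stub S3 `MultiShadowDecay` was reshaped (registration v4 of `Cruxes/EventualTight/Lines/Sketch.lean`)
into the glue S2′ (`Theorems.stub_shellCountOfCleanMultiShadow`, landed
`SAWRenewalTightnessEventualTightShellCountOfCleanMultiShadow`) and the atom S3′ `CleanMultiShadowDecay`, whose
bad event carries every FREE normalisation: each strand is CLEAN (its interior lies in the open shell) and all
strands are CO-ORIENTED.  Recorded here: the vocabulary, `MultiShadowDecay → CleanMultiShadowDecay` (event
inclusion), `CleanMultiShadowDecay → ShellCountTight` (S2′ + S1), and `CleanMultiShadowDecay ↔ EventualTight` —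
the reshaped atom is still exactly crux-sized (registered obligation `cleanMultiShadowDecay_iff_eventualTight`). -/

/-- **A clean strand**: the interior of the segment of `γ` on `[s, t]` lies in the OPEN shell
`r < |· − x| < R` (AB99 §1.b, remark after (1.2); the Kemppainen–Smirnov crossing segment). -/
def IsCleanStrand (γ : Curve ℂ) (x : ℂ) (r R : ℝ) (s t : I) : Prop :=
  ∀ u : I, s < u → u < t → r < dist (γ u) x ∧ dist (γ u) x < R

/-- **A clean, co-oriented, mutually shadowing family of `j` traversal strands**: as `HasShadowingFamily`,
every strand clean, and all strands start in the closed inner disc or all start outside the open outer disc. -/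
def HasCleanShadowingFamily (γ : Curve ℂ) (j : ℕ) (x : ℂ) (r R η : ℝ) : Prop :=
  ∃ s t : Fin j → I, (∀ i, γ.IsTraversal x r R (s i) (t i)) ∧
    ((∀ i, dist (γ (s i)) x ≤ r) ∨ (∀ i, R ≤ dist (γ (s i)) x)) ∧
    (∀ i, IsCleanStrand γ x r R (s i) (t i)) ∧
    (∀ ⦃i i' : Fin j⦄, i < i' → t i < s i') ∧
    ∀ (i i' : Fin j) (u : I), s i ≤ u → u ≤ t i → ∃ v : I, s i' ≤ v ∧ v ≤ t i' ∧ dist (γ u) (γ v) ≤ η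

/-- **CleanMultiShadowDecay** (S3′, the reshaped atom): per genuine shell and `θ > 0`, ONE resolution `η > 0`,
a strand number `j` and a mesh threshold `δ₁ > 0` such that `j` clean, co-oriented, pairwise mutually
`η`-shadowing separate traversal strands have probability `≤ θ` for all `δ ∈ (0, δ₁]`. -/
def CleanMultiShadowDecay : Prop :=
  ∀ (D : DobrushinDomain) (a b : ℝ → Site 2), SAW.IsEndpointApprox D a b →
    ∀ (x : ℂ) (r R : ℝ), 0 < r → r < R → ∀ θ : ℝ, 0 < θ →
      ∃ η : ℝ, 0 < η ∧ ∃ (j : ℕ) (δ₁ : ℝ), 0 < δ₁ ∧ ∀ δ ∈ Set.Ioc (0 : ℝ) δ₁,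
        SAW.law D.carrier δ (a δ) (b δ)
          {γ | HasCleanShadowingFamily (⟨γ.walk.toCurve (meshPoint δ)⟩ : Curve ℂ) j x r R η}
          ≤ ENNReal.ofReal θ

/-- **The glue, cleaned** (S2′): `Confinement → CleanMultiShadowDecay → ShellCountTight`. -/
def ShellCountOfCleanMultiShadow : Prop := Confinement → CleanMultiShadowDecay → ShellCountTight

/-- S2′ holds: the landed `Theorems.stub_shellCountOfCleanMultiShadow`, by unfolding. [folklore] -/
theorem shellCountOfCleanMultiShadow_holds : ShellCountOfCleanMultiShadow :=
  Theorems.stub_shellCountOfCleanMultiShadow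

/-- A clean co-oriented shadowing family is a shadowing family. [folklore] -/
theorem hasShadowingFamily_of_hasCleanShadowingFamily {γ : Curve ℂ} {j : ℕ} {x : ℂ} {r R η : ℝ}
    (h : HasCleanShadowingFamily γ j x r R η) : HasShadowingFamily γ j x r R η := by
  obtain ⟨s, t, hst, -, -, hsep, hclose⟩ := h
  exact ⟨s, t, hst, hsep, hclose⟩

/-- **The reshape weakens the atom**: `MultiShadowDecay → CleanMultiShadowDecay` (event inclusion). [folklore] -/
theorem cleanMultiShadowDecay_of_multiShadowDecay (h : MultiShadowDecay) : CleanMultiShadowDecay := by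
  intro D a b hab x r R hr hrR θ hθ
  obtain ⟨η, hη, j, δ₁, hδ₁, hbound⟩ := h D a b hab x r R hr hrR θ hθ
  refine ⟨η, hη, j, δ₁, hδ₁, fun δ hδ => le_trans (measure_mono fun γ hγ => ?_) (hbound δ hδ)⟩
  exact hasShadowingFamily_of_hasCleanShadowingFamily hγ

/-- The reshaped atom gives per-shell count tightness (S2′ with the landed S1). [folklore] -/
theorem shellCountTight_of_cleanMultiShadowDecay (h : CleanMultiShadowDecay) : ShellCountTight :=
  shellCountOfCleanMultiShadow_holds confinement_holds h

/-- **`CleanMultiShadowDecay ↔ EventualTight`**: the reshaped atom of the line `Sketch` is still exactly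
crux-sized — it is the crux with every deterministic normalisation pre-extracted. [folklore] -/
theorem cleanMultiShadowDecay_iff_eventualTight : CleanMultiShadowDecay ↔ EventualTight :=
  ⟨fun h => tightOfShellCount_holds (shellCountTight_of_cleanMultiShadowDecay h),
    fun hT => cleanMultiShadowDecay_of_multiShadowDecay (multiShadowDecay_of_eventualTight hT)⟩

/-- **Registered form** (crux item stmt-CriticalPhenomena-1372, obligation
`cleanMultiShadowDecay_iff_eventualTight`): the registered atom `stub_cleanMultiShadowDecay`, verbatim, `↔` the
crux decl. [folklore] -/
theorem _root_.Summit.CriticalPhenomena.SAWScalingLimit.Theorems.cleanMultiShadowDecay_iff_eventualTight :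
    (∀ (D : DobrushinDomain) (a b : ℝ → Site 2), SAW.IsEndpointApprox D a b →
      ∀ (x : ℂ) (r R : ℝ), 0 < r → r < R → ∀ θ : ℝ, 0 < θ →
        ∃ η : ℝ, 0 < η ∧ ∃ (j : ℕ) (δ₁ : ℝ), 0 < δ₁ ∧ ∀ δ ∈ Set.Ioc (0 : ℝ) δ₁,
          SAW.law D.carrier δ (a δ) (b δ)
            {γ | ∃ s t : Fin j → unitInterval,
              (∀ i, (⟨γ.walk.toCurve (meshPoint δ)⟩ : Curve ℂ).IsTraversal x r R (s i) (t i)) ∧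
              ((∀ i, dist ((⟨γ.walk.toCurve (meshPoint δ)⟩ : Curve ℂ) (s i)) x ≤ r) ∨
                (∀ i, R ≤ dist ((⟨γ.walk.toCurve (meshPoint δ)⟩ : Curve ℂ) (s i)) x)) ∧
              (∀ (i : Fin j) (u : unitInterval), s i < u → u < t i →
                r < dist ((⟨γ.walk.toCurve (meshPoint δ)⟩ : Curve ℂ) u) x ∧
                  dist ((⟨γ.walk.toCurve (meshPoint δ)⟩ : Curve ℂ) u) x < R) ∧
              (∀ ⦃i i' : Fin j⦄, i < i' → t i < s i') ∧
              ∀ (i i' : Fin j) (u : unitInterval), s i ≤ u → u ≤ t i →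
                ∃ v : unitInterval, s i' ≤ v ∧ v ≤ t i' ∧
                  dist ((⟨γ.walk.toCurve (meshPoint δ)⟩ : Curve ℂ) u)
                    ((⟨γ.walk.toCurve (meshPoint δ)⟩ : Curve ℂ) v) ≤ η}
            ≤ ENNReal.ofReal θ) ↔
    Summit.CriticalPhenomena.SAWScalingLimit.Theses.SAWRenewalTightness.EventualTight :=
  Summit.CriticalPhenomena.SAWScalingLimit.Theorems.EventualTight.Sketch.cleanMultiShadowDecay_iff_eventualTight

end Summit.CriticalPhenomena.SAWScalingLimit.Theorems.EventualTight.Sketch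

end
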